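import Summits.CriticalPhenomena.PercolationContinuityZ3.Theorems.PercNearOneGluingNoHeavyLowerTailThreeSum
import HarnessLib

/-!
# `NoHeavyLowerTail` (stmt-CriticalPhenomena-4575) — the 3-sum theorem for R1, measure level, part 7:
# the companion rows LB and LG are preserved under gluing along `{a,b,c}` (so R1 ∧ LB ∧ LG is CLOSED under 3-sums)

Support file (prover prim-gen-kcluster gen 71; `--supports stmt-CriticalPhenomena-4575`).  No definitions, no
named facts, no sorries.  Setting and cells exactly as in part 6 (`…ThreeSum`, theorem `ThreeSum.r1_of_threeSum`).

* `ThreeSum.table_Ua` — Boolean table of the glued cell `a|bc` (`= n_A n_B + n_A z_B + z_A n_B`, `n = a|bc`,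
  `z = a|b|c`), from the join rule for `b ~ c` (`ThreeSum.glued_atom_bc`).
* `ThreeSum.pt_Ua`, `ThreeSum.pt_N` — pointwise weight identities for the glued cells `U_a = a|bc` and
  `N_D = {a|b|c, not separated}`; `ThreeSum.glued_Ua_sum`, `ThreeSum.glued_N_sum` — the dictionary entries
  `K·Zφ(U_a) = q (R_A(n) R_B(n) + R_A(n) R_B(z) + R_A(z) R_B(n))`, `K·Zφ(N) = q² (R_A(z) R_B(z) − R_A(s) R_B(s))`.
* **`ThreeSum.lb_of_threeSum`, `ThreeSum.lg_of_threeSum`** — LB (`φ(S)φ(U_a) ≤ φ(N)φ(U_b)`) and LG for the glued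
  measure follow from LB resp. LG for the two pieces ALONE (algebraic cores `WheelR1.lb_glue`, `WheelR1.lg_glue`
  at `x = 0`, p375044; memo KCLUSTER-gen69 §5.1).
With part 6: **the triple of rows (R1, LB, LG) for the free random-cluster measure (any `q > 0`) of the instance
`(a; b, c)` is preserved under gluing along `{a,b,c}`**, hence (induction on bridges) holds on every graph all of
whose `{a,b,c}`-bridges satisfy it.
-/

noncomputable section

namespace Summit.CriticalPhenomena.PercolationContinuityZ3.Theorems

namespace ThreeSum

open Finset SimpleGraph Literature.Probability.Percolation Literature.Probability.Percolation.Gladkov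
open Literature.Probability.Percolation.BHK2006 (weight)
open Literature.Probability.Percolation.DecisionTree (ind ind_of_mem ind_of_not_mem ind_nonneg)
open Literature.Probability.LatticeModels RefinedRowR3 ThreePointLB MeasureTheory
open scoped Classical

variable {V : Type*} [Fintype V]

/-! ### Table of the cell `a|bc` -/

section Table

variable {αA γA κA αB γB κB : Prop} {x nA zA nB zB : ℝ}

/-- Table of the cell `a|bc` of the glued graph: `1[a|bc] = n_A n_B + n_A z_B + z_A n_B`. [this work] -/
theorem table_Ua (h1A : αA → γA → κA) (h2A : αA → κA → γA) (h3A : γA → κA → αA)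
    (h1B : αB → γB → κB) (h2B : αB → κB → γB) (h3B : γB → κB → αB)
    (hx1 : (¬ ((αA ∨ αB) ∨ ((γA ∨ γB) ∧ (κA ∨ κB))) ∧ ¬ ((γA ∨ γB) ∨ ((αA ∨ αB) ∧ (κA ∨ κB))) ∧
      ((κA ∨ κB) ∨ ((αA ∨ αB) ∧ (γA ∨ γB)))) → x = 1)
    (hx0 : ¬ (¬ ((αA ∨ αB) ∨ ((γA ∨ γB) ∧ (κA ∨ κB))) ∧ ¬ ((γA ∨ γB) ∨ ((αA ∨ αB) ∧ (κA ∨ κB))) ∧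
      ((κA ∨ κB) ∨ ((αA ∨ αB) ∧ (γA ∨ γB)))) → x = 0)
    (hnA1 : (¬αA ∧ ¬γA ∧ κA) → nA = 1) (hnA0 : ¬ (¬αA ∧ ¬γA ∧ κA) → nA = 0)
    (hnB1 : (¬αB ∧ ¬γB ∧ κB) → nB = 1) (hnB0 : ¬ (¬αB ∧ ¬γB ∧ κB) → nB = 0)
    (hzA1 : (¬αA ∧ ¬γA ∧ ¬κA) → zA = 1) (hzA0 : ¬ (¬αA ∧ ¬γA ∧ ¬κA) → zA = 0)
    (hzB1 : (¬αB ∧ ¬γB ∧ ¬κB) → zB = 1) (hzB0 : ¬ (¬αB ∧ ¬γB ∧ ¬κB) → zB = 0) :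
    x = nA * nB + nA * zB + zA * nB := by
  by_cases hαA : αA <;> by_cases hγA : γA <;> by_cases hκA : κA <;>
    by_cases hαB : αB <;> by_cases hγB : γB <;> by_cases hκB : κB <;> simp_all

end Table

/-! ### Pointwise identities for the cells `a|bc` and `N` -/

section Pointwise

variable {DA DB : Finset (Sym2 V)} {a b c : V} (hab : a ≠ b) (hac : a ≠ c) (hbc : b ≠ c)
  (hsepD : ∀ v : V, (∃ e ∈ DA, v ∈ e) → (∃ e ∈ DB, v ∈ e) → (v = a ∨ v = b ∨ v = c))
  (w : Sym2 V → unitInterval) (q : ℝ) (hw : ∀ e, e ∉ (↑DA ∪ ↑DB : Set (Sym2 V)) → (w e : ℝ) = 0)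
include hab hac hbc hsepD hw

/-- **Pointwise decomposition, cell `a|bc`.**  `w_φ(ω) 1_{a|bc}(ω) q^{k^T(∅)} =
weight(ω) · q · [F_n(ζ_A) F_n(ζ_B) + F_n(ζ_A) F_z(ζ_B) + F_z(ζ_A) F_n(ζ_B)]`. [this work] -/
theorem pt_Ua (ω : BondConfig V) :
    rcWeightW w q ∅ ω * ind {η : BondConfig V | b ∉ cl η.toFinset a ∧ c ∉ cl η.toFinset a ∧ c ∈ cl η.toFinset b} ω * q ^ clusterCount (∅ : BondConfig V) ({a, b, c} : Set V) =
      weight (fun e => (w e : ℝ)) ω * (q *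
        ((ind {η : BondConfig V | b ∉ cl η.toFinset a ∧ c ∉ cl η.toFinset a ∧ c ∈ cl η.toFinset b} (ω ∩ ↑DA) * q ^ clusterCount (ω ∩ ↑DA) ({a, b, c} : Set V)) * (ind {η : BondConfig V | b ∉ cl η.toFinset a ∧ c ∉ cl η.toFinset a ∧ c ∈ cl η.toFinset b} (ω \ ↑DA) * q ^ clusterCount (ω \ ↑DA) ({a, b, c} : Set V)) + (ind {η : BondConfig V | b ∉ cl η.toFinset a ∧ c ∉ cl η.toFinset a ∧ c ∈ cl η.toFinset b} (ω ∩ ↑DA) * q ^ clusterCount (ω ∩ ↑DA) ({a, b, c} : Set V)) * (ind {η : BondConfig V | b ∉ cl η.toFinset a ∧ c ∉ cl η.toFinset a ∧ c ∉ cl η.toFinset b} (ω \ ↑DA) * q ^ clusterCount (ω \ ↑DA) ({a, b, c} : Set V)) + (ind {η : BondConfig V | b ∉ cl η.toFinset a ∧ c ∉ cl η.toFinset a ∧ c ∉ cl η.toFinset b} (ω ∩ ↑DA) * q ^ clusterCount (ω ∩ ↑DA) ({a, b, c} : Set V)) * (ind {η : BondConfig V | b ∉ cl η.toFinset a ∧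 c ∉ cl η.toFinset a ∧ c ∈ cl η.toFinset b} (ω \ ↑DA) * q ^ clusterCount (ω \ ↑DA) ({a, b, c} : Set V)))) := by
  by_cases hω : ω ⊆ ↑DA ∪ ↑DB
  · obtain ⟨jab, jac⟩ := glued_atoms hsepD hω
    have jbc := glued_atom_bc (a := a) (b := b) (c := c) hsepD hω
    obtain ⟨t1A, t2A, t3A⟩ := trans_three (a := a) (b := b) (c := c) (ω ∩ (↑DA : Set (Sym2 V)))
    obtain ⟨t1B, t2B, t3B⟩ := trans_three (a := a) (b := b) (c := c) (ω \ (↑DA : Set (Sym2 V)))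
    have htab := table_Ua (x := ind {η : BondConfig V | b ∉ cl η.toFinset a ∧ c ∉ cl η.toFinset a ∧ c ∈ cl η.toFinset b} ω) (nA := ind {η : BondConfig V | b ∉ cl η.toFinset a ∧ c ∉ cl η.toFinset a ∧ c ∈ cl η.toFinset b} (ω ∩ ↑DA)) (nB := ind {η : BondConfig V | b ∉ cl η.toFinset a ∧ c ∉ cl η.toFinset a ∧ c ∈ cl η.toFinset b} (ω \ ↑DA))
      (zA := ind {η : BondConfig V | b ∉ cl η.toFinset a ∧ c ∉ cl η.toFinset a ∧ c ∉ cl η.toFinset b} (ω ∩ ↑DA)) (zB := ind {η : BondConfig V | b ∉ cl η.toFinset a ∧ c ∉ cl η.toFinset a ∧ c ∉ cl η.toFinset b} (ω \ ↑DA))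
      t1A t2A t3A t1B t2B t3B
      (fun h => ind_of_mem (show ω ∈ {η : BondConfig V | b ∉ cl η.toFinset a ∧ c ∉ cl η.toFinset a ∧ c ∈ cl η.toFinset b} from
        ⟨fun h' => h.1 (jab.1 h'), fun h' => h.2.1 (jac.1 h'), jbc.2 h.2.2⟩))
      (fun h => ind_of_not_mem (show ω ∉ {η : BondConfig V | b ∉ cl η.toFinset a ∧ c ∉ cl η.toFinset a ∧ c ∈ cl η.toFinset b} from
        fun h' => h ⟨fun h'' => h'.1 (jab.2 h''), fun h'' => h'.2.1 (jac.2 h''), jbc.1 h'.2.2⟩))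
      (fun h => ind_of_mem h) (fun h => ind_of_not_mem h) (fun h => ind_of_mem h) (fun h => ind_of_not_mem h)
      (fun h => ind_of_mem h) (fun h => ind_of_not_mem h) (fun h => ind_of_mem h) (fun h => ind_of_not_mem h)
    by_cases hU : ω ∈ {η : BondConfig V | b ∉ cl η.toFinset a ∧ c ∉ cl η.toFinset a ∧ c ∈ cl η.toFinset b}
    · have hk : clusterCount ω ∅ = clusterCount ω ({a, b, c} : Set V) + 1 := k_cell_N hab hac hbc ω hU.1 hU.2.2
      have hadd := kT_add hsepD hω
      have hpow : q ^ clusterCount ω ∅ * q ^ clusterCount (∅ : BondConfig V) ({a, b, c} : Set V) =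
          q * (q ^ clusterCount (ω ∩ ↑DA) ({a, b, c} : Set V) * q ^ clusterCount (ω \ ↑DA) ({a, b, c} : Set V)) := by
        rw [← pow_add, ← pow_add, hk, ← pow_succ', Nat.add_right_comm, hadd]
      unfold rcWeightW
      rw [htab]
      linear_combination (weight (fun e => (w e : ℝ)) ω *
        (ind {η : BondConfig V | b ∉ cl η.toFinset a ∧ c ∉ cl η.toFinset a ∧ c ∈ cl η.toFinset b} (ω ∩ ↑DA) * ind {η : BondConfig V | b ∉ cl η.toFinset a ∧ c ∉ cl η.toFinset a ∧ c ∈ cl η.toFinset b} (ω \ ↑DA) + ind {η : BondConfig V | b ∉ cl η.toFinset a ∧ c ∉ cl η.toFinset a ∧ c ∈ cl η.toFinset b} (ω ∩ ↑DA) * ind {η : BondConfig V | b ∉ cl η.toFinset a ∧ c ∉ cl η.toFinset a ∧ c ∉ cl η.toFinset b} (ω \ ↑DA) +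
          ind {η : BondConfig V | b ∉ cl η.toFinset a ∧ c ∉ cl η.toFinset a ∧ c ∉ cl η.toFinset b} (ω ∩ ↑DA) * ind {η : BondConfig V | b ∉ cl η.toFinset a ∧ c ∉ cl η.toFinset a ∧ c ∈ cl η.toFinset b} (ω \ ↑DA))) * hpow
    · have h0 : ind {η : BondConfig V | b ∉ cl η.toFinset a ∧ c ∉ cl η.toFinset a ∧ c ∈ cl η.toFinset b} ω = 0 := ind_of_not_mem hU
      rw [h0] at htab
      unfold rcWeightW
      rw [h0]
      linear_combination (weight (fun e => (w e : ℝ)) ω * q *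
        q ^ clusterCount (ω ∩ ↑DA) ({a, b, c} : Set V) * q ^ clusterCount (ω \ ↑DA) ({a, b, c} : Set V)) * htab
  · have h0 : weight (fun e => (w e : ℝ)) ω = 0 := weight_eq_zero_of_not_subset w hw hω
    unfold rcWeightW
    rw [h0]; ring

/-- **Pointwise decomposition, cell `N` (pairwise apart, not separated).**  `w_φ(ω) 1_{N_{DA∪DB}}(ω) q^{k^T(∅)} =
weight(ω) · q² · [F_z(ζ_A) F_z(ζ_B) − F_{S_{DA}}(ζ_A) F_{S_{DB}}(ζ_B)]`. [this work] -/
theorem pt_N (ω : BondConfig V) :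
    rcWeightW w q ∅ ω * ind {η : BondConfig V | b ∉ cl η.toFinset a ∧ c ∉ cl η.toFinset a ∧ c ∉ cl η.toFinset b ∧ ¬ Sep (DA ∪ DB) (cl η.toFinset a) b c} ω * q ^ clusterCount (∅ : BondConfig V) ({a, b, c} : Set V) =
      weight (fun e => (w e : ℝ)) ω * (q ^ 2 * ((ind {η : BondConfig V | b ∉ cl η.toFinset a ∧ c ∉ cl η.toFinset a ∧ c ∉ cl η.toFinset b} (ω ∩ ↑DA) * q ^ clusterCount (ω ∩ ↑DA) ({a, b, c} : Set V)) * (ind {η : BondConfig V | b ∉ cl η.toFinset a ∧ c ∉ cl η.toFinset a ∧ c ∉ cl η.toFinset b} (ω \ ↑DA) * q ^ clusterCount (ω \ ↑DA) ({a, b, c} : Set V)) - (ind {η : BondConfig V | b ∉ cl η.toFinset a ∧ c ∉ cl η.toFinset a ∧ Sep DA (cl η.toFinset a) b c} (ω ∩ ↑DA) * q ^ clusterCount (ω ∩ ↑DA) ({a, b, c} : Set V)) * (ind {η : BondConfig V | b ∉ cl η.toFinset a ∧ c ∉ cl η.toFinset a ∧ Sep DB (cl η.toFinset a) b c} (ω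 \ ↑DA) * q ^ clusterCount (ω \ ↑DA) ({a, b, c} : Set V)))) := by
  by_cases hω : ω ⊆ ↑DA ∪ ↑DB
  · obtain ⟨jab, jac⟩ := glued_atoms hsepD hω
    have jbc := glued_atom_bc (a := a) (b := b) (c := c) hsepD hω
    have hS := glued_S_iff (a := a) (b := b) (c := c) hab hsepD hω
    have hadd := kT_add hsepD hω
    -- the pairwise-apart cell of the glued graph is the product of the pieces' ones
    have hZ : ω ∈ {η : BondConfig V | b ∉ cl η.toFinset a ∧ c ∉ cl η.toFinset a ∧ c ∉ cl η.toFinset b} ↔ ((ω ∩ ↑DA) ∈ {η : BondConfig V | b ∉ cl η.toFinset a ∧ c ∉ cl η.toFinset a ∧ c ∉ cl η.toFinset b} ∧ (ω \ ↑DA) ∈ {η : BondConfig V | b ∉ cl η.toFinset a ∧ c ∉ cl η.toFinset a ∧ c ∉ cl η.toFinset b}) := by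
      constructor
      · intro h
        have hb := fun h' => h.1 (jab.2 h')
        have hc := fun h' => h.2.1 (jac.2 h')
        have hk := fun h' => h.2.2 (jbc.2 h')
        exact ⟨⟨fun h' => hb (Or.inl (Or.inl h')), fun h' => hc (Or.inl (Or.inl h')), fun h' => hk (Or.inl (Or.inl h'))⟩,
          ⟨fun h' => hb (Or.inl (Or.inr h')), fun h' => hc (Or.inl (Or.inr h')), fun h' => hk (Or.inl (Or.inr h'))⟩⟩
      · rintro ⟨⟨hbA, hcA, hkA⟩, ⟨hbB, hcB, hkB⟩⟩
        refine ⟨fun h' => ?_, fun h' => ?_, fun h' => ?_⟩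
        · rcases jab.1 h' with (h | h) | ⟨h | h, _⟩
          exacts [hbA h, hbB h, hcA h, hcB h]
        · rcases jac.1 h' with (h | h) | ⟨h | h, _⟩
          exacts [hcA h, hcB h, hbA h, hbB h]
        · rcases jbc.1 h' with (h | h) | ⟨h | h, _⟩
          exacts [hkA h, hkB h, hbA h, hbB h]
    -- separation forces the pairwise-apart cell (on the support)
    have hSZ : ω ∈ {η : BondConfig V | b ∉ cl η.toFinset a ∧ c ∉ cl η.toFinset a ∧ Sep (DA ∪ DB) (cl η.toFinset a) b c} → ω ∈ {η : BondConfig V | b ∉ cl η.toFinset a ∧ c ∉ cl η.toFinset a ∧ c ∉ cl η.toFinset b} := fun h =>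
      ⟨h.1, h.2.1, fun h' => not_sep_of_mem_cl (toFinset_subset_of_subset hω) h.1 h' h.2.2⟩
    by_cases hz : ω ∈ {η : BondConfig V | b ∉ cl η.toFinset a ∧ c ∉ cl η.toFinset a ∧ c ∉ cl η.toFinset b}
    · have hk : clusterCount ω ∅ = clusterCount ω ({a, b, c} : Set V) + 2 := k_cell_apart hab hac hbc ω hz.1 hz.2.1 hz.2.2
      have hpow : q ^ clusterCount ω ∅ * q ^ clusterCount (∅ : BondConfig V) ({a, b, c} : Set V) =
          q ^ 2 * (q ^ clusterCount (ω ∩ ↑DA) ({a, b, c} : Set V) * q ^ clusterCount (ω \ ↑DA) ({a, b, c} : Set V)) := by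
        rw [← pow_add, ← pow_add, ← pow_add, hk, Nat.add_right_comm, hadd, Nat.add_comm]
      obtain ⟨hzA, hzB⟩ := hZ.1 hz
      rw [ind_of_mem hzA, ind_of_mem hzB]
      by_cases hs : ω ∈ {η : BondConfig V | b ∉ cl η.toFinset a ∧ c ∉ cl η.toFinset a ∧ Sep (DA ∪ DB) (cl η.toFinset a) b c}
      · obtain ⟨hsA, hsB⟩ := hS.1 hs
        have hN : ω ∉ {η : BondConfig V | b ∉ cl η.toFinset a ∧ c ∉ cl η.toFinset a ∧ c ∉ cl η.toFinset b ∧ ¬ Sep (DA ∪ DB) (cl η.toFinset a) b c} := fun h => h.2.2.2 hs.2.2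
        unfold rcWeightW
        rw [ind_of_not_mem hN, ind_of_mem hsA, ind_of_mem hsB]
        ring
      · have hN : ω ∈ {η : BondConfig V | b ∉ cl η.toFinset a ∧ c ∉ cl η.toFinset a ∧ c ∉ cl η.toFinset b ∧ ¬ Sep (DA ∪ DB) (cl η.toFinset a) b c} := ⟨hz.1, hz.2.1, hz.2.2, fun h => hs ⟨hz.1, hz.2.1, h⟩⟩
        have h0 : ind {η : BondConfig V | b ∉ cl η.toFinset a ∧ c ∉ cl η.toFinset a ∧ Sep DA (cl η.toFinset a) b c} (ω ∩ ↑DA) * ind {η : BondConfig V | b ∉ cl η.toFinset a ∧ c ∉ cl η.toFinset a ∧ Sep DB (cl η.toFinset a) b c} (ω \ ↑DA) = 0 := by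
          by_cases hA : (ω ∩ ↑DA) ∈ {η : BondConfig V | b ∉ cl η.toFinset a ∧ c ∉ cl η.toFinset a ∧ Sep DA (cl η.toFinset a) b c}
          · have hB : (ω \ ↑DA) ∉ {η : BondConfig V | b ∉ cl η.toFinset a ∧ c ∉ cl η.toFinset a ∧ Sep DB (cl η.toFinset a) b c} := fun hB => hs (hS.2 ⟨hA, hB⟩)
            rw [ind_of_not_mem hB, mul_zero]
          · rw [ind_of_not_mem hA, zero_mul]
        unfold rcWeightW
        rw [ind_of_mem hN]
        linear_combination (weight (fun e => (w e : ℝ)) ω) * hpow +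
          (weight (fun e => (w e : ℝ)) ω * q ^ 2 *
            q ^ clusterCount (ω ∩ ↑DA) ({a, b, c} : Set V) * q ^ clusterCount (ω \ ↑DA) ({a, b, c} : Set V)) * h0
    · have hN : ω ∉ {η : BondConfig V | b ∉ cl η.toFinset a ∧ c ∉ cl η.toFinset a ∧ c ∉ cl η.toFinset b ∧ ¬ Sep (DA ∪ DB) (cl η.toFinset a) b c} := fun h => hz ⟨h.1, h.2.1, h.2.2.1⟩
      have hs : ω ∉ {η : BondConfig V | b ∉ cl η.toFinset a ∧ c ∉ cl η.toFinset a ∧ Sep (DA ∪ DB) (cl η.toFinset a) b c} := fun h => hz (hSZ h)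
      have h0 : ind {η : BondConfig V | b ∉ cl η.toFinset a ∧ c ∉ cl η.toFinset a ∧ c ∉ cl η.toFinset b} (ω ∩ ↑DA) * ind {η : BondConfig V | b ∉ cl η.toFinset a ∧ c ∉ cl η.toFinset a ∧ c ∉ cl η.toFinset b} (ω \ ↑DA) = 0 := by
        by_cases hA : (ω ∩ ↑DA) ∈ {η : BondConfig V | b ∉ cl η.toFinset a ∧ c ∉ cl η.toFinset a ∧ c ∉ cl η.toFinset b}
        · have hB : (ω \ ↑DA) ∉ {η : BondConfig V | b ∉ cl η.toFinset a ∧ c ∉ cl η.toFinset a ∧ c ∉ cl η.toFinset b} := fun hB => hz (hZ.2 ⟨hA, hB⟩)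
          rw [ind_of_not_mem hB, mul_zero]
        · rw [ind_of_not_mem hA, zero_mul]
      have h1 : ind {η : BondConfig V | b ∉ cl η.toFinset a ∧ c ∉ cl η.toFinset a ∧ Sep DA (cl η.toFinset a) b c} (ω ∩ ↑DA) * ind {η : BondConfig V | b ∉ cl η.toFinset a ∧ c ∉ cl η.toFinset a ∧ Sep DB (cl η.toFinset a) b c} (ω \ ↑DA) = 0 := by
        by_cases hA : (ω ∩ ↑DA) ∈ {η : BondConfig V | b ∉ cl η.toFinset a ∧ c ∉ cl η.toFinset a ∧ Sep DA (cl η.toFinset a) b c}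
        · have hB : (ω \ ↑DA) ∉ {η : BondConfig V | b ∉ cl η.toFinset a ∧ c ∉ cl η.toFinset a ∧ Sep DB (cl η.toFinset a) b c} := fun hB => hs (hS.2 ⟨hA, hB⟩)
          rw [ind_of_not_mem hB, mul_zero]
        · rw [ind_of_not_mem hA, zero_mul]
      unfold rcWeightW
      rw [ind_of_not_mem hN]
      linear_combination (-(weight (fun e => (w e : ℝ)) ω * q ^ 2 *
          q ^ clusterCount (ω ∩ ↑DA) ({a, b, c} : Set V) * q ^ clusterCount (ω \ ↑DA) ({a, b, c} : Set V))) * h0 +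
        (weight (fun e => (w e : ℝ)) ω * q ^ 2 *
          q ^ clusterCount (ω ∩ ↑DA) ({a, b, c} : Set V) * q ^ clusterCount (ω \ ↑DA) ({a, b, c} : Set V)) * h1
  · have h0 : weight (fun e => (w e : ℝ)) ω = 0 := weight_eq_zero_of_not_subset w hw hω
    unfold rcWeightW
    rw [h0]; ring

end Pointwise

/-! ### The dictionary entries for `a|bc` and `N`, and the rows LB, LG of the glued graph -/

section Sums

variable {DA DB D : Finset (Sym2 V)} {a b c : V} (hab : a ≠ b) (hac : a ≠ c) (hbc : b ≠ c)
  (hsepD : ∀ v : V, (∃ e ∈ DA, v ∈ e) → (∃ e ∈ DB, v ∈ e) → (v = a ∨ v = b ∨ v = c))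
  (w wA wB : Sym2 V → unitInterval) (q : ℝ) (hw : ∀ e, e ∉ (↑DA ∪ ↑DB : Set (Sym2 V)) → (w e : ℝ) = 0)
  (hA : ∀ e ∈ (↑DA : Set (Sym2 V)), wA e = w e) (hA' : ∀ e ∉ (↑DA : Set (Sym2 V)), wA e = 0)
  (hB : ∀ e ∈ (↑DA : Set (Sym2 V)), wB e = 0) (hB' : ∀ e ∉ (↑DA : Set (Sym2 V)), wB e = w e)
include hab hac hbc hsepD hw hA hA' hB hB'

/-- **Dictionary, cell `a|bc`**: `K · Zφ(a|bc) = q · (R_A(n) R_B(n) + R_A(n) R_B(z) + R_A(z) R_B(n))`. [this work] -/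
theorem glued_Ua_sum :
    (∑ ω : BondConfig V, rcWeightW w q ∅ ω * ind {η : BondConfig V | b ∉ cl η.toFinset a ∧ c ∉ cl η.toFinset a ∧ c ∈ cl η.toFinset b} ω) * q ^ clusterCount (∅ : BondConfig V) ({a, b, c} : Set V) =
      q * ((∑ η : BondConfig V, rcWeightW wA q ({a, b, c} : Set V) η * ind {η : BondConfig V | b ∉ cl η.toFinset a ∧ c ∉ cl η.toFinset a ∧ c ∈ cl η.toFinset b} η) * (∑ η : BondConfig V, rcWeightW wB q ({a, b, c} : Set V) η * ind {η : BondConfig V | b ∉ cl η.toFinset a ∧ c ∉ cl η.toFinset a ∧ c ∈ cl η.toFinset b} η) + (∑ η : BondConfig V, rcWeightW wA q ({a, b, c} : Set V) η * ind {η : BondConfig V | b ∉ cl η.toFinset a ∧ c ∉ cl η.toFinset a ∧ c ∈ cl η.toFinset b} η) * (∑ η : BondConfig V, rcWeightW wB q ({a, b, c} : Set V) η * ind {η : BondConfig V | b ∉ cl η.toFinset a ∧ c ∉ cl η.toFinset a ∧ c ∉ cl η.toFinset b} η) + (∑ η : BondConfig V, rcWeightW wA q ({a, b, c} : Set V) η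 * ind {η : BondConfig V | b ∉ cl η.toFinset a ∧ c ∉ cl η.toFinset a ∧ c ∉ cl η.toFinset b} η) * (∑ η : BondConfig V, rcWeightW wB q ({a, b, c} : Set V) η * ind {η : BondConfig V | b ∉ cl η.toFinset a ∧ c ∉ cl η.toFinset a ∧ c ∈ cl η.toFinset b} η)) := by
  rw [Finset.sum_mul, Finset.sum_congr rfl fun ω _ => pt_Ua hab hac hbc hsepD w q hw ω]
  have e1 := sum_weight_inter_mul_sdiff w wA wB (↑DA) hA hA' hB hB'
    (fun x => ind {η : BondConfig V | b ∉ cl η.toFinset a ∧ c ∉ cl η.toFinset a ∧ c ∈ cl η.toFinset b} x * q ^ clusterCount x ({a, b, c} : Set V)) (fun y => ind {η : BondConfig V | b ∉ cl η.toFinset a ∧ c ∉ cl η.toFinset a ∧ c ∈ cl η.toFinset b} y * q ^ clusterCount y ({a, b, c} : Set V))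
  have e2 := sum_weight_inter_mul_sdiff w wA wB (↑DA) hA hA' hB hB'
    (fun x => ind {η : BondConfig V | b ∉ cl η.toFinset a ∧ c ∉ cl η.toFinset a ∧ c ∈ cl η.toFinset b} x * q ^ clusterCount x ({a, b, c} : Set V)) (fun y => ind {η : BondConfig V | b ∉ cl η.toFinset a ∧ c ∉ cl η.toFinset a ∧ c ∉ cl η.toFinset b} y * q ^ clusterCount y ({a, b, c} : Set V))
  have e3 := sum_weight_inter_mul_sdiff w wA wB (↑DA) hA hA' hB hB'
    (fun x => ind {η : BondConfig V | b ∉ cl η.toFinset a ∧ c ∉ cl η.toFinset a ∧ c ∉ cl η.toFinset b} x * q ^ clusterCount x ({a, b, c} : Set V)) (fun y => ind {η : BondConfig V | b ∉ cl η.toFinset a ∧ c ∉ cl η.toFinset a ∧ c ∈ cl η.toFinset b} y * q ^ clusterCount y ({a, b, c} : Set V))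
  beta_reduce at e1 e2 e3
  rw [← sum_weight_ind_pow wA q _ {η : BondConfig V | b ∉ cl η.toFinset a ∧ c ∉ cl η.toFinset a ∧ c ∈ cl η.toFinset b}, ← sum_weight_ind_pow wA q _ {η : BondConfig V | b ∉ cl η.toFinset a ∧ c ∉ cl η.toFinset a ∧ c ∉ cl η.toFinset b},
    ← sum_weight_ind_pow wB q _ {η : BondConfig V | b ∉ cl η.toFinset a ∧ c ∉ cl η.toFinset a ∧ c ∈ cl η.toFinset b}, ← sum_weight_ind_pow wB q _ {η : BondConfig V | b ∉ cl η.toFinset a ∧ c ∉ cl η.toFinset a ∧ c ∉ cl η.toFinset b}, ← e1, ← e2, ← e3,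
    ← Finset.sum_add_distrib, ← Finset.sum_add_distrib, Finset.mul_sum]
  refine Finset.sum_congr rfl fun ω _ => by ring

/-- **Dictionary, cell `N`**: `K · Zφ(N_{DA∪DB}) = q² · (R_A(z) R_B(z) − R_A(S_{DA}) R_B(S_{DB}))`. [this work] -/
theorem glued_N_sum :
    (∑ ω : BondConfig V, rcWeightW w q ∅ ω * ind {η : BondConfig V | b ∉ cl η.toFinset a ∧ c ∉ cl η.toFinset a ∧ c ∉ cl η.toFinset b ∧ ¬ Sep (DA ∪ DB) (cl η.toFinset a) b c} ω) * q ^ clusterCount (∅ : BondConfig V) ({a, b, c} : Set V) =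
      q ^ 2 * ((∑ η : BondConfig V, rcWeightW wA q ({a, b, c} : Set V) η * ind {η : BondConfig V | b ∉ cl η.toFinset a ∧ c ∉ cl η.toFinset a ∧ c ∉ cl η.toFinset b} η) * (∑ η : BondConfig V, rcWeightW wB q ({a, b, c} : Set V) η * ind {η : BondConfig V | b ∉ cl η.toFinset a ∧ c ∉ cl η.toFinset a ∧ c ∉ cl η.toFinset b} η) - (∑ η : BondConfig V, rcWeightW wA q ({a, b, c} : Set V) η * ind {η : BondConfig V | b ∉ cl η.toFinset a ∧ c ∉ cl η.toFinset a ∧ Sep DA (cl η.toFinset a) b c} η) * (∑ η : BondConfig V, rcWeightW wB q ({a, b, c} : Set V) η * ind {η : BondConfig V | b ∉ cl η.toFinset a ∧ c ∉ cl η.toFinset a ∧ Sep DB (cl η.toFinset a) b c} η)) := by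
  rw [Finset.sum_mul, Finset.sum_congr rfl fun ω _ => pt_N hab hac hbc hsepD w q hw ω]
  have e1 := sum_weight_inter_mul_sdiff w wA wB (↑DA) hA hA' hB hB'
    (fun x => ind {η : BondConfig V | b ∉ cl η.toFinset a ∧ c ∉ cl η.toFinset a ∧ c ∉ cl η.toFinset b} x * q ^ clusterCount x ({a, b, c} : Set V)) (fun y => ind {η : BondConfig V | b ∉ cl η.toFinset a ∧ c ∉ cl η.toFinset a ∧ c ∉ cl η.toFinset b} y * q ^ clusterCount y ({a, b, c} : Set V))
  have e2 := sum_weight_inter_mul_sdiff w wA wB (↑DA) hA hA' hB hB'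
    (fun x => ind {η : BondConfig V | b ∉ cl η.toFinset a ∧ c ∉ cl η.toFinset a ∧ Sep DA (cl η.toFinset a) b c} x * q ^ clusterCount x ({a, b, c} : Set V)) (fun y => ind {η : BondConfig V | b ∉ cl η.toFinset a ∧ c ∉ cl η.toFinset a ∧ Sep DB (cl η.toFinset a) b c} y * q ^ clusterCount y ({a, b, c} : Set V))
  beta_reduce at e1 e2
  rw [← sum_weight_ind_pow wA q _ {η : BondConfig V | b ∉ cl η.toFinset a ∧ c ∉ cl η.toFinset a ∧ c ∉ cl η.toFinset b}, ← sum_weight_ind_pow wB q _ {η : BondConfig V | b ∉ cl η.toFinset a ∧ c ∉ cl η.toFinset a ∧ c ∉ cl η.toFinset b},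
    ← sum_weight_ind_pow wA q _ {η : BondConfig V | b ∉ cl η.toFinset a ∧ c ∉ cl η.toFinset a ∧ Sep DA (cl η.toFinset a) b c}, ← sum_weight_ind_pow wB q _ {η : BondConfig V | b ∉ cl η.toFinset a ∧ c ∉ cl η.toFinset a ∧ Sep DB (cl η.toFinset a) b c}, ← e1, ← e2,
    ← Finset.sum_sub_distrib, Finset.mul_sum]
  refine Finset.sum_congr rfl fun ω _ => by ring

variable {q} (hq : 0 < q) (hD : ∀ e, e ∈ D ↔ e ∈ DA ∨ e ∈ DB)
include hq hD

/-- **LB is preserved under gluing along `{a,b,c}`** (every `q > 0`): LB for `φ_A` (support `DA`) and for `φ_B`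
(support `DB`) ⟹ LB `φ(S)·φ(U_a) ≤ φ(N)·φ(U_b)` for the glued measure (support `D`).  Algebraic core
`WheelR1.lb_glue` at `x = 0`. [this work] -/
theorem lb_of_threeSum
    (hLBA : (rcMeasureW wA q ∅).real {η : BondConfig V | b ∉ cl η.toFinset a ∧ c ∉ cl η.toFinset a ∧ Sep DA (cl η.toFinset a) b c} * (rcMeasureW wA q ∅).real {η : BondConfig V | b ∉ cl η.toFinset a ∧ c ∉ cl η.toFinset a ∧ c ∈ cl η.toFinset b} ≤ (rcMeasureW wA q ∅).real {η : BondConfig V | b ∉ cl η.toFinset a ∧ c ∉ cl η.toFinset a ∧ c ∉ cl η.toFinset b ∧ ¬ Sep DA (cl η.toFinset a) b c} * (rcMeasureW wA q ∅).real {η : BondConfig V | b ∈ cl η.toFinset a ∧ c ∉ cl η.toFinset a})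
    (hLBB : (rcMeasureW wB q ∅).real {η : BondConfig V | b ∉ cl η.toFinset a ∧ c ∉ cl η.toFinset a ∧ Sep DB (cl η.toFinset a) b c} * (rcMeasureW wB q ∅).real {η : BondConfig V | b ∉ cl η.toFinset a ∧ c ∉ cl η.toFinset a ∧ c ∈ cl η.toFinset b} ≤ (rcMeasureW wB q ∅).real {η : BondConfig V | b ∉ cl η.toFinset a ∧ c ∉ cl η.toFinset a ∧ c ∉ cl η.toFinset b ∧ ¬ Sep DB (cl η.toFinset a) b c} * (rcMeasureW wB q ∅).real {η : BondConfig V | b ∈ cl η.toFinset a ∧ c ∉ cl η.toFinset a}) :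
    (rcMeasureW w q ∅).real {η : BondConfig V | b ∉ cl η.toFinset a ∧ c ∉ cl η.toFinset a ∧ Sep D (cl η.toFinset a) b c} * (rcMeasureW w q ∅).real {η : BondConfig V | b ∉ cl η.toFinset a ∧ c ∉ cl η.toFinset a ∧ c ∈ cl η.toFinset b} ≤ (rcMeasureW w q ∅).real {η : BondConfig V | b ∉ cl η.toFinset a ∧ c ∉ cl η.toFinset a ∧ c ∉ cl η.toFinset b ∧ ¬ Sep D (cl η.toFinset a) b c} * (rcMeasureW w q ∅).real {η : BondConfig V | b ∈ cl η.toFinset a ∧ c ∉ cl η.toFinset a} := by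
  have hwA : ∀ e, e ∉ (↑DA : Set (Sym2 V)) → (wA e : ℝ) = 0 := fun e he => by rw [hA' e he]; rfl
  have hwB : ∀ e, e ∉ (↑DB : Set (Sym2 V)) → (wB e : ℝ) = 0 := by
    intro e he
    by_cases heA : e ∈ (↑DA : Set (Sym2 V))
    · rw [hB e heA]; rfl
    · rw [hB' e heA]; exact hw e (fun h => h.elim heA he)
  have hDD : D = DA ∪ DB := by ext e; rw [Finset.mem_union]; exact hD e
  subst hDD
  have hZ := rcPartitionFunctionW_pos w hq (∅ : Set V)
  have hZA := rcPartitionFunctionW_pos wA hq (∅ : Set V)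
  have hZB := rcPartitionFunctionW_pos wB hq (∅ : Set V)
  have hK : 0 < q ^ clusterCount (∅ : BondConfig V) ({a, b, c} : Set V) := pow_pos hq _
  have hnn : ∀ (u : Sym2 V → unitInterval) (E : Set (BondConfig V)),
      0 ≤ ∑ η : BondConfig V, rcWeightW u q ({a, b, c} : Set V) η * ind E η := fun u E =>
    Finset.sum_nonneg fun η _ => mul_nonneg (rcWeightW_nonneg u hq.le _ η) (ind_nonneg E η)
  simp only [rcMeasureW_real_eq_sum_div w hq, rcMeasureW_real_eq_sum_div wA hq,
    rcMeasureW_real_eq_sum_div wB hq] at hLBA hLBB ⊢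
  rw [piece_Ub hab hac hbc, piece_N hab hac hbc, piece_S hab hac hbc wA q hwA, piece_E hab hac hbc] at hLBA
  rw [piece_Ub hab hac hbc, piece_N hab hac hbc, piece_S hab hac hbc wB q hwB, piece_E hab hac hbc] at hLBB
  rw [div_mul_div_comm, div_mul_div_comm]
  refine div_le_div_of_nonneg_right ?_ (mul_pos hZ hZ).le
  refine le_of_mul_le_mul_right (a := q ^ clusterCount (∅ : BondConfig V) ({a, b, c} : Set V) *
    q ^ clusterCount (∅ : BondConfig V) ({a, b, c} : Set V)) ?_ (mul_pos hK hK)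
  have eS := glued_S_sum hab hac hbc hsepD w wA wB q hw hA hA' hB hB'
  have eUa := glued_Ua_sum hab hac hbc hsepD w wA wB q hw hA hA' hB hB'
  have eN := glued_N_sum hab hac hbc hsepD w wA wB q hw hA hA' hB hB'
  have eUb := glued_Ub_sum hab hac hbc hsepD w wA wB q hw hA hA' hB hB'
  rw [show ∀ x y K : ℝ, x * y * (K * K) = (x * K) * (y * K) from fun x y K => by ring, eS, eUa,
    show ∀ x y K : ℝ, x * y * (K * K) = (x * K) * (y * K) from fun x y K => by ring, eN, eUb]
  have splitA := piece_split wA q hwA (a := a) (b := b) (c := c)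
  have splitB := piece_split wB q hwB (a := a) (b := b) (c := c)
  set bA' := (∑ η : BondConfig V, rcWeightW wA q ({a, b, c} : Set V) η * ind {η : BondConfig V | b ∈ cl η.toFinset a ∧ c ∉ cl η.toFinset a} η) with hbA
  set nA := (∑ η : BondConfig V, rcWeightW wA q ({a, b, c} : Set V) η * ind {η : BondConfig V | b ∉ cl η.toFinset a ∧ c ∉ cl η.toFinset a ∧ c ∈ cl η.toFinset b} η) with hnA
  set zA := (∑ η : BondConfig V, rcWeightW wA q ({a, b, c} : Set V) η * ind {η : BondConfig V | b ∉ cl η.toFinset a ∧ c ∉ cl η.toFinset a ∧ c ∉ cl η.toFinset b} η) with hzA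
  set sA := (∑ η : BondConfig V, rcWeightW wA q ({a, b, c} : Set V) η * ind {η : BondConfig V | b ∉ cl η.toFinset a ∧ c ∉ cl η.toFinset a ∧ Sep DA (cl η.toFinset a) b c} η) with hsA
  set eA := (∑ η : BondConfig V, rcWeightW wA q ({a, b, c} : Set V) η * ind {η : BondConfig V | b ∉ cl η.toFinset a ∧ c ∉ cl η.toFinset a ∧ c ∉ cl η.toFinset b ∧ ¬ Sep DA (cl η.toFinset a) b c} η) with heA
  set bB' := (∑ η : BondConfig V, rcWeightW wB q ({a, b, c} : Set V) η * ind {η : BondConfig V | b ∈ cl η.toFinset a ∧ c ∉ cl η.toFinset a} η) with hbB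
  set nB := (∑ η : BondConfig V, rcWeightW wB q ({a, b, c} : Set V) η * ind {η : BondConfig V | b ∉ cl η.toFinset a ∧ c ∉ cl η.toFinset a ∧ c ∈ cl η.toFinset b} η) with hnB
  set zB := (∑ η : BondConfig V, rcWeightW wB q ({a, b, c} : Set V) η * ind {η : BondConfig V | b ∉ cl η.toFinset a ∧ c ∉ cl η.toFinset a ∧ c ∉ cl η.toFinset b} η) with hzB
  set sB := (∑ η : BondConfig V, rcWeightW wB q ({a, b, c} : Set V) η * ind {η : BondConfig V | b ∉ cl η.toFinset a ∧ c ∉ cl η.toFinset a ∧ Sep DB (cl η.toFinset a) b c} η) with hsB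
  set eB := (∑ η : BondConfig V, rcWeightW wB q ({a, b, c} : Set V) η * ind {η : BondConfig V | b ∉ cl η.toFinset a ∧ c ∉ cl η.toFinset a ∧ c ∉ cl η.toFinset b ∧ ¬ Sep DB (cl η.toFinset a) b c} η) with heB
  have lbA' : sA * nA ≤ eA * bA' := by
    rw [div_mul_div_comm, div_mul_div_comm, div_le_div_iff_of_pos_right (mul_pos hZA hZA)] at hLBA
    refine le_of_mul_le_mul_left (a := q ^ 3) ?_ (pow_pos hq 3)
    calc q ^ 3 * (sA * nA) = q ^ 2 * sA * (q * nA) := by ring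
      _ ≤ q ^ 2 * eA * (q * bA') := hLBA
      _ = q ^ 3 * (eA * bA') := by ring
  have lbB' : sB * nB ≤ eB * bB' := by
    rw [div_mul_div_comm, div_mul_div_comm, div_le_div_iff_of_pos_right (mul_pos hZB hZB)] at hLBB
    refine le_of_mul_le_mul_left (a := q ^ 3) ?_ (pow_pos hq 3)
    calc q ^ 3 * (sB * nB) = q ^ 2 * sB * (q * nB) := by ring
      _ ≤ q ^ 2 * eB * (q * bB') := hLBB
      _ = q ^ 3 * (eB * bB') := by ring
  have cert := WheelR1.lb_glue eA sA bA' nA eB sB bB' nB 0 (hnn _ _) (hnn _ _) (hnn _ _) (hnn _ _)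
    (hnn _ _) (hnn _ _) (hnn _ _) (hnn _ _) le_rfl lbA' lbB'
  have hc3 := mul_le_mul_of_nonneg_left cert (pow_pos hq 3).le
  rw [splitA, splitB]
  convert hc3 using 1 <;> ring

/-- **LG is preserved under gluing along `{a,b,c}`** (every `q > 0`): LG for both pieces ⟹ LG
`φ(S)·φ(U_a) ≤ φ(N)·φ(U_c)` for the glued measure.  Algebraic core `WheelR1.lg_glue` at `y = 0`. [this work] -/
theorem lg_of_threeSum
    (hLGA : (rcMeasureW wA q ∅).real {η : BondConfig V | b ∉ cl η.toFinset a ∧ c ∉ cl η.toFinset a ∧ Sep DA (cl η.toFinset a) b c} * (rcMeasureW wA q ∅).real {η : BondConfig V | b ∉ cl η.toFinset a ∧ c ∉ cl η.toFinset a ∧ c ∈ cl η.toFinset b} ≤ (rcMeasureW wA q ∅).real {η : BondConfig V | b ∉ cl η.toFinset a ∧ c ∉ cl η.toFinset a ∧ c ∉ cl η.toFinset b ∧ ¬ Sep DA (cl η.toFinset a) b c} * (rcMeasureW wA q ∅).real {η : BondConfig V | b ∉ cl η.toFinset a ∧ c ∈ cl η.toFinset a})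
    (hLGB : (rcMeasureW wB q ∅).real {η : BondConfig V | b ∉ cl η.toFinset a ∧ c ∉ cl η.toFinset a ∧ Sep DB (cl η.toFinset a) b c} * (rcMeasureW wB q ∅).real {η : BondConfig V | b ∉ cl η.toFinset a ∧ c ∉ cl η.toFinset a ∧ c ∈ cl η.toFinset b} ≤ (rcMeasureW wB q ∅).real {η : BondConfig V | b ∉ cl η.toFinset a ∧ c ∉ cl η.toFinset a ∧ c ∉ cl η.toFinset b ∧ ¬ Sep DB (cl η.toFinset a) b c} * (rcMeasureW wB q ∅).real {η : BondConfig V | b ∉ cl η.toFinset a ∧ c ∈ cl η.toFinset a}) :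
    (rcMeasureW w q ∅).real {η : BondConfig V | b ∉ cl η.toFinset a ∧ c ∉ cl η.toFinset a ∧ Sep D (cl η.toFinset a) b c} * (rcMeasureW w q ∅).real {η : BondConfig V | b ∉ cl η.toFinset a ∧ c ∉ cl η.toFinset a ∧ c ∈ cl η.toFinset b} ≤ (rcMeasureW w q ∅).real {η : BondConfig V | b ∉ cl η.toFinset a ∧ c ∉ cl η.toFinset a ∧ c ∉ cl η.toFinset b ∧ ¬ Sep D (cl η.toFinset a) b c} * (rcMeasureW w q ∅).real {η : BondConfig V | b ∉ cl η.toFinset a ∧ c ∈ cl η.toFinset a} := by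
  have hwA : ∀ e, e ∉ (↑DA : Set (Sym2 V)) → (wA e : ℝ) = 0 := fun e he => by rw [hA' e he]; rfl
  have hwB : ∀ e, e ∉ (↑DB : Set (Sym2 V)) → (wB e : ℝ) = 0 := by
    intro e he
    by_cases heA : e ∈ (↑DA : Set (Sym2 V))
    · rw [hB e heA]; rfl
    · rw [hB' e heA]; exact hw e (fun h => h.elim heA he)
  have hDD : D = DA ∪ DB := by ext e; rw [Finset.mem_union]; exact hD e
  subst hDD
  have hZ := rcPartitionFunctionW_pos w hq (∅ : Set V)
  have hZA := rcPartitionFunctionW_pos wA hq (∅ : Set V)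
  have hZB := rcPartitionFunctionW_pos wB hq (∅ : Set V)
  have hK : 0 < q ^ clusterCount (∅ : BondConfig V) ({a, b, c} : Set V) := pow_pos hq _
  have hnn : ∀ (u : Sym2 V → unitInterval) (E : Set (BondConfig V)),
      0 ≤ ∑ η : BondConfig V, rcWeightW u q ({a, b, c} : Set V) η * ind E η := fun u E =>
    Finset.sum_nonneg fun η _ => mul_nonneg (rcWeightW_nonneg u hq.le _ η) (ind_nonneg E η)
  simp only [rcMeasureW_real_eq_sum_div w hq, rcMeasureW_real_eq_sum_div wA hq,
    rcMeasureW_real_eq_sum_div wB hq] at hLGA hLGB ⊢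
  rw [piece_Uc hab hac hbc, piece_N hab hac hbc, piece_S hab hac hbc wA q hwA, piece_E hab hac hbc] at hLGA
  rw [piece_Uc hab hac hbc, piece_N hab hac hbc, piece_S hab hac hbc wB q hwB, piece_E hab hac hbc] at hLGB
  rw [div_mul_div_comm, div_mul_div_comm]
  refine div_le_div_of_nonneg_right ?_ (mul_pos hZ hZ).le
  refine le_of_mul_le_mul_right (a := q ^ clusterCount (∅ : BondConfig V) ({a, b, c} : Set V) *
    q ^ clusterCount (∅ : BondConfig V) ({a, b, c} : Set V)) ?_ (mul_pos hK hK)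
  have eS := glued_S_sum hab hac hbc hsepD w wA wB q hw hA hA' hB hB'
  have eUa := glued_Ua_sum hab hac hbc hsepD w wA wB q hw hA hA' hB hB'
  have eN := glued_N_sum hab hac hbc hsepD w wA wB q hw hA hA' hB hB'
  have eUc := glued_Uc_sum hab hac hbc hsepD w wA wB q hw hA hA' hB hB'
  rw [show ∀ x y K : ℝ, x * y * (K * K) = (x * K) * (y * K) from fun x y K => by ring, eS, eUa,
    show ∀ x y K : ℝ, x * y * (K * K) = (x * K) * (y * K) from fun x y K => by ring, eN, eUc]
  have splitA := piece_split wA q hwA (a := a) (b := b) (c := c)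
  have splitB := piece_split wB q hwB (a := a) (b := b) (c := c)
  set gA := (∑ η : BondConfig V, rcWeightW wA q ({a, b, c} : Set V) η * ind {η : BondConfig V | b ∉ cl η.toFinset a ∧ c ∈ cl η.toFinset a} η) with hgA
  set nA := (∑ η : BondConfig V, rcWeightW wA q ({a, b, c} : Set V) η * ind {η : BondConfig V | b ∉ cl η.toFinset a ∧ c ∉ cl η.toFinset a ∧ c ∈ cl η.toFinset b} η) with hnA
  set zA := (∑ η : BondConfig V, rcWeightW wA q ({a, b, c} : Set V) η * ind {η : BondConfig V | b ∉ cl η.toFinset a ∧ c ∉ cl η.toFinset a ∧ c ∉ cl η.toFinset b} η) with hzA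
  set sA := (∑ η : BondConfig V, rcWeightW wA q ({a, b, c} : Set V) η * ind {η : BondConfig V | b ∉ cl η.toFinset a ∧ c ∉ cl η.toFinset a ∧ Sep DA (cl η.toFinset a) b c} η) with hsA
  set eA := (∑ η : BondConfig V, rcWeightW wA q ({a, b, c} : Set V) η * ind {η : BondConfig V | b ∉ cl η.toFinset a ∧ c ∉ cl η.toFinset a ∧ c ∉ cl η.toFinset b ∧ ¬ Sep DA (cl η.toFinset a) b c} η) with heA
  set gB := (∑ η : BondConfig V, rcWeightW wB q ({a, b, c} : Set V) η * ind {η : BondConfig V | b ∉ cl η.toFinset a ∧ c ∈ cl η.toFinset a} η) with hgB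
  set nB := (∑ η : BondConfig V, rcWeightW wB q ({a, b, c} : Set V) η * ind {η : BondConfig V | b ∉ cl η.toFinset a ∧ c ∉ cl η.toFinset a ∧ c ∈ cl η.toFinset b} η) with hnB
  set zB := (∑ η : BondConfig V, rcWeightW wB q ({a, b, c} : Set V) η * ind {η : BondConfig V | b ∉ cl η.toFinset a ∧ c ∉ cl η.toFinset a ∧ c ∉ cl η.toFinset b} η) with hzB
  set sB := (∑ η : BondConfig V, rcWeightW wB q ({a, b, c} : Set V) η * ind {η : BondConfig V | b ∉ cl η.toFinset a ∧ c ∉ cl η.toFinset a ∧ Sep DB (cl η.toFinset a) b c} η) with hsB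
  set eB := (∑ η : BondConfig V, rcWeightW wB q ({a, b, c} : Set V) η * ind {η : BondConfig V | b ∉ cl η.toFinset a ∧ c ∉ cl η.toFinset a ∧ c ∉ cl η.toFinset b ∧ ¬ Sep DB (cl η.toFinset a) b c} η) with heB
  have lgA' : sA * nA ≤ eA * gA := by
    rw [div_mul_div_comm, div_mul_div_comm, div_le_div_iff_of_pos_right (mul_pos hZA hZA)] at hLGA
    refine le_of_mul_le_mul_left (a := q ^ 3) ?_ (pow_pos hq 3)
    calc q ^ 3 * (sA * nA) = q ^ 2 * sA * (q * nA) := by ring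
      _ ≤ q ^ 2 * eA * (q * gA) := hLGA
      _ = q ^ 3 * (eA * gA) := by ring
  have lgB' : sB * nB ≤ eB * gB := by
    rw [div_mul_div_comm, div_mul_div_comm, div_le_div_iff_of_pos_right (mul_pos hZB hZB)] at hLGB
    refine le_of_mul_le_mul_left (a := q ^ 3) ?_ (pow_pos hq 3)
    calc q ^ 3 * (sB * nB) = q ^ 2 * sB * (q * nB) := by ring
      _ ≤ q ^ 2 * eB * (q * gB) := hLGB
      _ = q ^ 3 * (eB * gB) := by ring
  have cert := WheelR1.lg_glue eA sA gA nA eB sB gB nB 0 (hnn _ _) (hnn _ _) (hnn _ _) (hnn _ _)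
    (hnn _ _) (hnn _ _) (hnn _ _) (hnn _ _) le_rfl lgA' lgB'
  have hc3 := mul_le_mul_of_nonneg_left cert (pow_pos hq 3).le
  rw [splitA, splitB]
  convert hc3 using 1 <;> ring

end Sums

end ThreeSum

end Summit.CriticalPhenomena.PercolationContinuityZ3.Theorems
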